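import Mathlib
import Summits.Ventures.PercRepro2.K5StarGenBridge

/-!
# THE GENERAL-STAR CERTIFICATES, II: THE DEAD EDGE ON TOP, AND THE KILL
(blind cell PercRepro2, mine-2 g41, 2026-08-29; `proofs/MINE2-GENSTAR.md` §2–§3)

Every table of the crux kernel `K₃` carries the factor `Q = {a₁ ↮ a₂}` in every copy, so

* **the kill** — a placement in which some copy's mask contains the root edge `a₁a₂` (edge `4` of `K₅`)
  contributes nothing (`K3_eq_zero_of_four`, `mcount_eq_zero_of_four`): the placement sum is the
  masked-count sum over the ALIVE placements (`msum_eq_msum_alive`); a star with both roots of type `2`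
  has no alive placement at all (its statement is `0 ≥ 0`, no certificate);
* **the dead edge on top** — a Kronecker number of a masked table vanishes at every profile with
  `k₄ ≠ 0`, so with the edges `4` and `9` EXCHANGED in the index (`swC`: the configuration read through
  `Equiv.swap 4 9`; `tsw T`, the table through the swap) the number is below `KB8 ^ (4^9)`: a quarter of
  the length, a quarter of the memory, the products four times cheaper.  `cOn_swap`: the masked triple
  count of the swapped tables at the profile `k` is that of the tables at the swapped profile;
  `posOn38sw` / `negOn38sw` and their encodings; **`cSumL_neg_le_pos_sw`**: one certificate on the swapped
  list sums gives the digit inequality at EVERY profile;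
* **`starNonnegGen_of_certsw`** — `StarNonnegGen R 0 1 2 3 b L` from one `CertLE8` on the alive placements
  of `L` in the swapped index (an empty list when the star is killed).

Own code; standard axioms.
-/

namespace Summit.Ventures.PercRepro2

open Hub

namespace K5

/-! ## The kill: the root edge open in a copy annihilates the kernel -/

section Kill

set_option maxRecDepth 100000 in
/-- `Q` fails when the root edge `a₁a₂` (edge `4`) is open. -/
lemma tQ_four : ∀ ω : Fin 10 → Bool, ω 4 = true → tQ ω = false := by decide +kernel

variable {R : Type*} [Field R]

/-- **The kill**: the kernel `K₃` on `K₅` vanishes when the root edge is open in some copy. -/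
theorem K3_eq_zero_of_four (b : Fin 5) (x y w : Config (Fin 10))
    (h : x 4 = true ∨ y 4 = true ∨ w 4 = true) :
    CovForm.K3 (R := R) ends5 0 1 2 3 b x y w = 0 := by
  rw [K3_apply]
  rcases h with h | h | h
  · simp [indR, tPD, tPDoU, tQ_four _ h]
  · simp [indR, tPD, tPDoU, t7p, t7m, t12, tQ_four _ h]
  · simp [indR, tPD, tPDoU, t4p, t4m, t5p, t5m, t6p, t6m, t7p, t7m, t10p, t10m, t11, tQ_four _ h]

/-- A masked count with the root edge in some mask vanishes. -/
theorem mcount_eq_zero_of_four (b : Fin 5) (F : Finset (Fin 10)) (z : Config (Fin 10)) (τ : Fin 10 → ℕ)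
    (S₁ S₂ S₃ : Fin 10 → Bool) (h : S₁ 4 = true ∨ S₂ 4 = true ∨ S₃ 4 = true) :
    mcount F z τ S₁ S₂ S₃ (CovForm.K3 (R := R) ends5 0 1 2 3 b) = 0 := by
  unfold mcount typedCount
  refine Finset.sum_eq_zero fun x _ => Finset.sum_eq_zero fun y _ => Finset.sum_eq_zero fun w _ => ?_
  split_ifs
  · apply K3_eq_zero_of_four
    rcases h with h | h | h
    · exact Or.inl (by simp [orOn, h])
    · exact Or.inr (Or.inl (by simp [orOn, h]))
    · exact Or.inr (Or.inr (by simp [orOn, h]))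
  · rfl

/-- A mask triple is ALIVE when no copy's mask contains the root edge. -/
def alive (t : Mask3) : Bool := !(t.1 4 || t.2.1 4 || t.2.2 4)

/-- The masked-count sum is the sum over the alive triples. -/
theorem msum_eq_msum_alive (b : Fin 5) (F : Finset (Fin 10)) (z : Config (Fin 10)) (τ : Fin 10 → ℕ) :
    ∀ ms : List Mask3, msum F z τ (CovForm.K3 (R := R) ends5 0 1 2 3 b) ms =
      msum F z τ (CovForm.K3 (R := R) ends5 0 1 2 3 b) (ms.filter alive)
  | [] => by simp [msum]
  | t :: ms => by
    rw [msum, msum_eq_msum_alive b F z τ ms]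
    by_cases ha : alive t = true
    · rw [List.filter_cons_of_pos ha, msum]
    · rw [List.filter_cons_of_neg ha, mcount_eq_zero_of_four b F z τ t.1 t.2.1 t.2.2, zero_add]
      unfold alive at ha
      cases h1 : t.1 4 <;> cases h2 : t.2.1 4 <;> cases h3 : t.2.2 4 <;> simp_all

end Kill

/-! ## The dead edge on top: the index through the swap `(4 9)` -/

section Swap

/-- The transposition of the edges `4` (the root edge `a₁a₂`) and `9`. -/
def swE : Fin 10 → Fin 10 := fun j => Equiv.swap (4 : Fin 10) 9 j

/-- `swE` is an involution. -/
lemma swE_swE (j : Fin 10) : swE (swE j) = j := by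
  unfold swE
  exact Equiv.swap_apply_self _ _ _

/-- A configuration (or mask) read through the swap. -/
def swC (ω : Fin 10 → Bool) : Fin 10 → Bool := fun j => ω (swE j)

/-- `swC` is an involution. -/
lemma swC_swC (ω : Fin 10 → Bool) : swC (swC ω) = ω := by
  funext j
  simp [swC, swE_swE]

/-- A table read through the swap. -/
def tsw (T : (Fin 10 → Bool) → Bool) : (Fin 10 → Bool) → Bool := fun ω => T (swC ω)

/-- A swapped mask on a configuration is the swap of the mask on the swapped configuration. -/
lemma orOn_swC (S ω : Fin 10 → Bool) : orOn (swC S) ω = swC (orOn S (swC ω)) := by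
  funext j
  simp [orOn, swC, swE_swE]

/-- The swapped table through the swapped mask is the table through the mask at the swapped configuration. -/
lemma tsw_orOn_swC (T : (Fin 10 → Bool) → Bool) (S ω : Fin 10 → Bool) :
    tsw T (orOn (swC S) ω) = T (orOn S (swC ω)) := by
  unfold tsw
  rw [orOn_swC, swC_swC]

/-- A profile read through the swap. -/
def swP (k : Fin 10 → Fin 4) : Fin 10 → Fin 4 := fun i => k (swE i)

/-- `swP` is an involution. -/
lemma swP_swP (k : Fin 10 → Fin 4) : swP (swP k) = k := by
  funext i
  simp [swP, swE_swE]

/-- The profile of swapped configurations is the swapped profile. -/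
lemma prof_swC (x y w : Fin 10 → Bool) : prof (swC x) (swC y) (swC w) = swP (prof x y w) := by
  funext i
  rfl

/-- The swap on triples of configurations. -/
def swT (t : (Fin 10 → Bool) × (Fin 10 → Bool) × (Fin 10 → Bool)) :
    (Fin 10 → Bool) × (Fin 10 → Bool) × (Fin 10 → Bool) := (swC t.1, swC t.2.1, swC t.2.2)

/-- `swT` is an involution. -/
lemma swT_involutive : Function.Involutive swT := by
  intro t
  simp [swT, swC_swC]

/-- **Reindexing**: the masked triple count of the swapped tables through the swapped masks at `k` is
the masked triple count of the tables through the masks at the swapped profile. -/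
theorem cOn_swap (T₁ T₂ T₃ : (Fin 10 → Bool) → Bool) (S₁ S₂ S₃ : Fin 10 → Bool) (k : Fin 10 → Fin 4) :
    cOn (tsw T₁) (tsw T₂) (tsw T₃) (swC S₁) (swC S₂) (swC S₃) k = cOn T₁ T₂ T₃ S₁ S₂ S₃ (swP k) := by
  unfold cOn cnt3
  rw [Finset.sum_filter, Finset.sum_filter]
  refine Fintype.sum_equiv swT_involutive.toPerm _ _ fun t => ?_
  simp only [Function.Involutive.coe_toPerm, swT, tsw_orOn_swC, prof_swC]
  have hiff : prof t.1 t.2.1 t.2.2 = k ↔ swP (prof t.1 t.2.1 t.2.2) = swP k := by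
    constructor
    · intro h; rw [h]
    · intro h; have := congrArg swP h; rwa [swP_swP, swP_swP] at this
  by_cases h : prof t.1 t.2.1 t.2.2 = k
  · rw [if_pos h, if_pos (hiff.1 h)]
  · rw [if_neg h, if_neg (fun h' => h (hiff.2 h'))]

/-- A product of three numbers that the kernel never multiplies when a factor is zero (every zero factor
is tested first; a masked table killed by the identification costs no multiplication). -/
def prod3 (a b c : ℕ) : ℕ := if a = 0 then 0 else if b = 0 then 0 else if c = 0 then 0 else a * b * c

/-- `prod3` is the product. -/
lemma prod3_eq (a b c : ℕ) : prod3 a b c = a * b * c := by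
  unfold prod3
  split_ifs <;> simp_all

/-- The positive products of `K₃` in the swapped index (through `prod3`). -/
def posOn38sw (b : ℕ) (S₁ S₂ S₃ : Fin 10 → Bool) : ℕ :=
  prod3 (kron38 (tsw tPD) (swC S₁)) (kron38 (tsw tQ) (swC S₂)) (kron38 (tsw (t4p b)) (swC S₃)) +
    prod3 (kron38 (tsw tQ) (swC S₁)) (kron38 (tsw tPDoU) (swC S₂)) (kron38 (tsw (t5p b)) (swC S₃)) +
    prod3 (kron38 (tsw tPD) (swC S₁)) (kron38 (tsw tQ) (swC S₂)) (kron38 (tsw (t6m b)) (swC S₃)) +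
    prod3 (kron38 (tsw tPD) (swC S₁)) (kron38 (tsw (t7p b)) (swC S₂)) (kron38 (tsw (t7m 0)) (swC S₃)) +
    prod3 (kron38 (tsw tPD) (swC S₁)) (kron38 (tsw (t7m b)) (swC S₂)) (kron38 (tsw (t7p 0)) (swC S₃)) +
    prod3 (kron38 (tsw tPDoU) (swC S₁)) (kron38 (tsw (t7p b)) (swC S₂)) (kron38 (tsw (t7m 3)) (swC S₃)) +
    prod3 (kron38 (tsw tPDoU) (swC S₁)) (kron38 (tsw (t7m b)) (swC S₂)) (kron38 (tsw (t7p 3)) (swC S₃)) +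
    prod3 (kron38 (tsw tPD) (swC S₁)) (kron38 (tsw (t7p b)) (swC S₂)) (kron38 (tsw t10p) (swC S₃)) +
    prod3 (kron38 (tsw tPD) (swC S₁)) (kron38 (tsw (t7m b)) (swC S₂)) (kron38 (tsw t10m) (swC S₃)) +
    prod3 (kron38 (tsw tQ) (swC S₁)) (kron38 (tsw (t12 b)) (swC S₂)) (kron38 (tsw tPDoU) (swC S₃))

/-- The negative products of `K₃` in the swapped index (through `prod3`). -/
def negOn38sw (b : ℕ) (S₁ S₂ S₃ : Fin 10 → Bool) : ℕ :=
  prod3 (kron38 (tsw tPD) (swC S₁)) (kron38 (tsw tQ) (swC S₂)) (kron38 (tsw (t4m b)) (swC S₃)) +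
    prod3 (kron38 (tsw tQ) (swC S₁)) (kron38 (tsw tPDoU) (swC S₂)) (kron38 (tsw (t5m b)) (swC S₃)) +
    prod3 (kron38 (tsw tPD) (swC S₁)) (kron38 (tsw tQ) (swC S₂)) (kron38 (tsw (t6p b)) (swC S₃)) +
    prod3 (kron38 (tsw tPD) (swC S₁)) (kron38 (tsw (t7p b)) (swC S₂)) (kron38 (tsw (t7p 0)) (swC S₃)) +
    prod3 (kron38 (tsw tPD) (swC S₁)) (kron38 (tsw (t7m b)) (swC S₂)) (kron38 (tsw (t7m 0)) (swC S₃)) +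
    prod3 (kron38 (tsw tPDoU) (swC S₁)) (kron38 (tsw (t7p b)) (swC S₂)) (kron38 (tsw (t7p 3)) (swC S₃)) +
    prod3 (kron38 (tsw tPDoU) (swC S₁)) (kron38 (tsw (t7m b)) (swC S₂)) (kron38 (tsw (t7m 3)) (swC S₃)) +
    prod3 (kron38 (tsw tPD) (swC S₁)) (kron38 (tsw (t7p b)) (swC S₂)) (kron38 (tsw t10m) (swC S₃)) +
    prod3 (kron38 (tsw tPD) (swC S₁)) (kron38 (tsw (t7m b)) (swC S₂)) (kron38 (tsw t10p) (swC S₃)) +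
    prod3 (kron38 (tsw tPD) (swC S₁)) (kron38 (tsw tQ) (swC S₂)) (kron38 (tsw (t11 b)) (swC S₃))

/-- `posOn38sw b` encodes `cPosOn3b b` at the swapped profiles. -/
lemma posOn38sw_eq (b : ℕ) (S₁ S₂ S₃ : Fin 10 → Bool) :
    posOn38sw b S₁ S₂ S₃ = ∑ k, cPosOn3b b S₁ S₂ S₃ (swP k) * KB8 ^ idx4 k := by
  unfold posOn38sw
  simp only [prod3_eq, kron38_mul_mul]
  rw [sum_add_mul10_8]
  refine Finset.sum_congr rfl fun k _ => ?_
  unfold cPosOn3b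
  simp only [← cOn_swap]
  rfl

/-- `negOn38sw b` encodes `cNegOn3b b` at the swapped profiles. -/
lemma negOn38sw_eq (b : ℕ) (S₁ S₂ S₃ : Fin 10 → Bool) :
    negOn38sw b S₁ S₂ S₃ = ∑ k, cNegOn3b b S₁ S₂ S₃ (swP k) * KB8 ^ idx4 k := by
  unfold negOn38sw
  simp only [prod3_eq, kron38_mul_mul]
  rw [sum_add_mul10_8]
  refine Finset.sum_congr rfl fun k _ => ?_
  unfold cNegOn3b
  simp only [← cOn_swap]
  rfl

/-- A coefficient sum of a reindexed coefficient function. -/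
lemma cSumL_comp (c : (Fin 10 → Bool) → (Fin 10 → Bool) → (Fin 10 → Bool) → (Fin 10 → Fin 4) → ℕ)
    (g : (Fin 10 → Fin 4) → (Fin 10 → Fin 4)) :
    ∀ (ms : List Mask3) (k : Fin 10 → Fin 4),
      cSumL (fun S₁ S₂ S₃ k => c S₁ S₂ S₃ (g k)) ms k = cSumL c ms (g k)
  | [], k => by simp [cSumL]
  | t :: ms, k => by
    rw [cSumL, cSumL, cSumL_comp c g ms k]

/-- **The digit inequality from one certificate in the swapped index**, at every profile. -/
theorem cSumL_neg_le_pos_sw (b : ℕ) (ms : List Mask3) (hlen : ms.length ≤ 454)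
    (hc : CertLE8 (sumL (negOn38sw b) ms) (sumL (posOn38sw b) ms)) (k : Fin 10 → Fin 4) :
    cSumL (cNegOn3b b) ms k ≤ cSumL (cPosOn3b b) ms k := by
  have h := le_of_certLE8 (cSumL (fun S₁ S₂ S₃ k => cPosOn3b b S₁ S₂ S₃ (swP k)) ms)
    (cSumL (fun S₁ S₂ S₃ k => cNegOn3b b S₁ S₂ S₃ (swP k)) ms)
    (cSumL_lt _ (fun S₁ S₂ S₃ k => cPosOn3b_le b S₁ S₂ S₃ (swP k)) ms hlen)
    (cSumL_lt _ (fun S₁ S₂ S₃ k => cNegOn3b_le b S₁ S₂ S₃ (swP k)) ms hlen)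
    (sumL_eq _ _ (posOn38sw_eq b) ms) (sumL_eq _ _ (negOn38sw_eq b) ms) hc (swP k)
  have e1 := cSumL_comp (cPosOn3b b) swP ms (swP k)
  have e2 := cSumL_comp (cNegOn3b b) swP ms (swP k)
  rw [e1, e2, swP_swP] at h
  exact h

variable {R : Type*} [Field R] [LinearOrder R] [IsStrictOrderedRing R]

/-- **One swapped certificate gives the nonnegativity of the masked-count sum.** -/
theorem msum_nonneg_of_certsw (n : ℕ) (b : Fin 5) (hb : (b : ℕ) = n) (ms : List Mask3)
    (hlen : ms.length ≤ 454) (hc : CertLE8 (sumL (negOn38sw n) ms) (sumL (posOn38sw n) ms))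
    (F : Finset (Fin 10)) (τ : Fin 10 → ℕ) :
    0 ≤ msum F (fun _ => false) τ (CovForm.K3 (R := R) ends5 0 1 2 3 b) ms := by
  subst hb
  by_cases hτ : ∀ e ∈ F, τ e ≤ 3
  · obtain ⟨k, hk⟩ := exists_profile F (fun _ => false) τ hτ
    rw [msum_eq b F _ τ k hk ms]
    have h := cSumL_neg_le_pos_sw b ms hlen hc k
    have h' : ((cSumL (cNegOn3b b) ms k : ℕ) : R) ≤ ((cSumL (cPosOn3b b) ms k : ℕ) : R) := by
      exact_mod_cast h
    linarith
  · have : ∀ ms' : List Mask3, msum F (fun _ => false) τ (CovForm.K3 (R := R) ends5 0 1 2 3 b) ms' = 0 := by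
      intro ms'
      induction ms' with
      | nil => simp [msum]
      | cons t ms' ih => rw [msum, ih, mcount_eq_zero_of_gt3 F _ τ hτ, add_zero]
    rw [this]

/-- **`StarNonnegGen` from one swapped certificate on the alive placements**: once the alive placements
of `L` (through the clique masks) are the literal mask list `ms`, the certificate `CertLE8` on the swapped
list sums gives row 2′TRI on `K₅ + u` with the star `L` (an empty `ms` needs no computation). -/
theorem starNonnegGen_of_certsw (n : ℕ) (b : Fin 5) (hb : (b : ℕ) = n) (L : List (Fin 5 × ℕ))
    (ms : List Mask3) (hms : ((placeList L ∅ ∅ ∅).map cmask3).filter alive = ms)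
    (hlen : ms.length ≤ 454) (hc : CertLE8 (sumL (negOn38sw n) ms) (sumL (posOn38sw n) ms)) :
    StarNonnegGen R 0 1 2 3 b L := by
  intro F τ _
  rw [placeSum_eq_msum, msum_eq_msum_alive, hms]
  exact msum_nonneg_of_certsw n b hb ms hlen hc F τ

/-- The empty certificate. -/
theorem certLE8_nil (f g : (Fin 10 → Bool) → (Fin 10 → Bool) → (Fin 10 → Bool) → ℕ) :
    CertLE8 (sumL f []) (sumL g []) := by
  unfold CertLE8 sumL
  decide +kernel

end Swap

end K5

end Summit.Ventures.PercRepro2
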